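import Summits.QuantumFields.YangMills.Theorems.BalabanUVNodesPortS1JacobianGauge
import Summits.QuantumFields.YangMills.Theorems.BalabanUVNodesPortS1JacobianHoloDefs

/-!
# NODE O port PT-A — ROW (a) OF `stub_LZjac` ON ONE TORUS: the holomorphic Jacobian factor `jacFactorC c = log det A₁^ℂ(c)(·)` (✓ `…JacobianHoloDefs`) is ℂ-ANALYTIC at every matrix field whose
# (0.4) loop matrices lie in the polydisc `‖W − 1‖ < 1`, whose average at `c` is invertible and whose `det A₁^ℂ(c)` is off the closed negative axis; and AT THE RECORD's `SU(2)` FIELDS in the guard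
# `A₁^ℂ(c)(↑Vk) = A₁(c)(Vk)` (DEF-1's real block), so `jacFactorC c ↑Vk = log|det A₁(c)(Vk)|` = the Jacobian factor of `phiLZjac` (✓p812199) whenever `det A₁(c)(Vk) > 0`

Cell `ym-nodeO-ideate`, porter seat `ymgap-nodeO-port-PTA-1` (gen 5); `--supports stmt-QuantumFields-27930` (helper; row (a) of the registered stub `stub_LZjac` of the reshaped skeleton `pta_residueW` at the
level of ONE torus — the reference-torus ∕ integer-formula packaging of PORT-PLAN-v5 §4 (e) is NOT here).  [I] = [Balaban1987RG1], [15] = [Balaban1985Variational].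
CONSUMED BY NAME, nothing modified: the tree's ℂ-differentiable adjugate model `B15AveragingHolomorphic` (`avgMh`, `holMh`, `stepMh`, `loopMh`, `corrMh`, `avgMh_coeField`, `coe_avgFun_eq_avgMh`,
`differentiableAt_avgMh_coeField`, `loopMh_coeField`), `ExpMeanLog.analyticAt_eml`, ✓p811778 (`recordLQt_apply_eq_fderiv_avgM`, `hasDerivAt_coe_pert_line`, `sum_su2Coord_smul_su2Gen`), ✓p812054
(`coe_mul_star_self_SU`, `star_mul_coe_self_SU`), ✓p812159 (`fluctMat_single`), ✓p811152 (`recordLQt_mem_lieSU_of_small`), dag-n07's velocity brick and guard persistence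
(`N07CentralDescendantLifts.hasDerivAt_coe_avgFun_comp_apply_of_small_of_local`, `N07AveragingLocalSmooth.eventually_small_comp_of_small_of_local`), Mathlib's `ContDiffAt.fderiv_right ∕ clm_apply`,
`contDiffAt_ringInverse`, `ContDiffAt.analyticAt` (`C^ω ⇒ analytic`), `AnalyticAt.clog`, `Matrix.det_fin_three`, `Matrix.adjugate_fin_two`.
* §1 `su2CoordC_sum_smul_su2Gen`, `su2CoordC_of_mem_lieSU` (on 𝔰𝔲(2) the complex coordinates are the real ones), `contDiff_su2CoordC`.
* §2 THE MODEL IS `C^ω` OVER ℂ (`N = 2`): `adjugate_eq_trace_smul_one_sub` (`adj A = tr A·1 − A`), `contDiff_adjugate_two`, `contDiff_stepMh_two`, `contDiff_holMh_two`, ★ `contDiffAt_avgMh_two`.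
* §3 THE BRIDGE AT `SU(2)` FIELDS: ★★ `fderiv_avgM_tangent_eq_fderiv_avgMh` (real and holomorphic responses agree on tangent directions — both are the velocity of the SU-valued chart curve, along which
  `avgMh = avgM`), ★★ `recordLQt_apply_eq_fderiv_avgMh`, `inv_coe_avgFun`, ★★ `jacBlockC_coeField` (`A₁^ℂ(c)(↑Vk) = A₁(c)(Vk)`), `det_jacBlockC_coeField`, ★ `jacFactorC_coeField`.
* §4 ANALYTICITY: ★★ `contDiffAt_jacBlockC_apply`, ★★ `contDiffAt_det_jacBlockC`, ★★ `analyticAt_jacFactorC`, ★★ `analyticAt_jacFactorC_coeField`.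

HONEST FRAMING.  Kernel calculus over the tree's own holomorphic model; NOTHING of Bałaban's estimates asserted, ported or discharged; this is row (a) for ONE torus and ONE factor — the composition
with `axialize ∘ Ū^k` (holomorphic editions), the uniform bound (b) on the (1.11)–(1.16) domain, rows (c)(d) in the complex model and the packaging (e) remain (PORT-PLAN-v5 §4); `stub_LZjac` OPEN;
`stub_LZdet` BLOCKED-ON P0 (α)+(β); `stub_FE` XXL; 27930 OPEN · no claim; K0⁷∕K-Ax OPEN; NODE O 0∕1; COUNT 8∕28 · K 1∕4 UNMOVED; finite `𝕋⁴_{L^K}` at fixed ε — NOT continuum ∕ OS ∕ Clay;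
**the Yang–Mills mass gap is NOT proved by any of this.**  No `sorry`, no `def`, no `instance`, no `notation`; standard axioms.
-/

noncomputable section

open scoped BigOperators Matrix.Norms.L2Operator Topology

namespace Summit.QuantumFields.YangMills.Theorems.BalabanUVNodesPortS1

open Summit.QuantumFields.YangMills.Theorems.K0RecordFormatNames
open Summit.QuantumFields.YangMills.BalabanUVNodes
open Literature.MathematicalPhysics.QuantumFieldTheory.Balaban1983to89
open Literature.MathematicalPhysics.QuantumFieldTheory.Balaban1983to89.Node00
open Literature.MathematicalPhysics.QuantumFieldTheory.Balaban1983to89.T4Continuum (T4Family)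
open Literature.MathematicalPhysics.QuantumFieldTheory.Balaban1983to89.BlockAveraging (avgFun loopHol Small Idx)
open Literature.MathematicalPhysics.QuantumFieldTheory.Balaban1983to89.BlockAveragingHaarAC (centralBond)
open Literature.MathematicalPhysics.QuantumFieldTheory.Balaban1983to89.ExpMeanLog (expMeanLogSU eml analyticAt_eml)
open Literature.MathematicalPhysics.QuantumFieldTheory.Balaban1983to89.B15AveragingHolomorphic
open Literature.MathematicalPhysics.QuantumFieldTheory.Balaban1983to89.T4AdjointCovarianceUnitary (lieSU mem_lieSU_iff)
open _root_.Matrix _root_.Filter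

/-! ## §1  Complex coordinates on 𝔰𝔲(2) -/

/-- `su2CoordC` reads the coefficients of a complex combination of `su2Gen`. [folklore] -/
theorem su2CoordC_sum_smul_su2Gen (z : Fin 3 → ℂ) (i : Fin 3) : su2CoordC (∑ a, z a • su2Gen a) i = z i := by
  fin_cases i <;> simp [su2CoordC, su2Gen, Fin.sum_univ_three, Matrix.add_apply] <;> ring_nf <;> simp [Complex.I_sq]

/-- On 𝔰𝔲(2) the complex coordinates are the real ones: `su2CoordC M = su2Coord M`. [folklore] -/
theorem su2CoordC_of_mem_lieSU {M : MatA 2} (hM : M ∈ lieSU (Fin 2)) (i : Fin 3) : su2CoordC M i = ((su2Coord M i : ℝ) : ℂ) := by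
  have hM' : M = ∑ a, ((su2Coord M a : ℝ) : ℂ) • su2Gen a := (sum_su2Coord_smul_su2Gen hM).symm
  conv_lhs => rw [hM']
  exact su2CoordC_sum_smul_su2Gen _ i

/-- `su2CoordC_i` is a continuous ℂ-linear function of the matrix (`C^ω`). [folklore] -/
theorem contDiff_su2CoordC (i : Fin 3) : ContDiff ℂ ⊤ (fun M : MatA 2 => su2CoordC M i) := by
  have he : ∀ a b : Fin 2, ContDiff ℂ ⊤ (fun M : MatA 2 => M a b) := fun a b =>
    (LinearMap.toContinuousLinearMap (Matrix.entryLinearMap ℂ ℂ a b)).contDiff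
  fin_cases i
  · show ContDiff ℂ ⊤ (fun M : MatA 2 => -Complex.I * (M 0 1 + M 1 0) / 2)
    exact ((contDiff_const.mul ((he 0 1).add (he 1 0))).div_const _)
  · show ContDiff ℂ ⊤ (fun M : MatA 2 => (M 0 1 - M 1 0) / 2)
    exact (((he 0 1).sub (he 1 0))).div_const _
  · show ContDiff ℂ ⊤ (fun M : MatA 2 => -Complex.I * M 0 0)
    exact contDiff_const.mul (he 0 0)

/-! ## §2  The holomorphic (0.4) model is `C^ω` over ℂ on the polydisc (`N = 2`: the adjugate is affine-linear) -/

section Model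

variable {P : Params} {j : ℕ}

/-- For `2 × 2` matrices the adjugate is affine-linear: `adj A = (tr A)·1 − A` (Cayley–Hamilton). [folklore] -/
theorem adjugate_eq_trace_smul_one_sub (A : MatA 2) : A.adjugate = A.trace • (1 : MatA 2) - A := by
  rw [Matrix.adjugate_fin_two]
  ext i j
  fin_cases i <;> fin_cases j <;> simp [Matrix.trace, Fin.sum_univ_two]

/-- The adjugate is `C^ω` on `M₂(ℂ)`. [folklore] -/
theorem contDiff_adjugate_two : ContDiff ℂ ⊤ (fun A : MatA 2 => A.adjugate) := by
  have hfun : (fun A : MatA 2 => A.adjugate) = fun A => A.trace • (1 : MatA 2) - A := funext adjugate_eq_trace_smul_one_sub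
  rw [hfun]
  have htr : ContDiff ℂ ⊤ (fun A : MatA 2 => A.trace) := (LinearMap.toContinuousLinearMap (Matrix.traceLinearMap (Fin 2) ℂ ℂ)).contDiff
  exact (htr.smul contDiff_const).sub contDiff_id

/-- Holomorphic step matrices are `C^ω`. [cite: Balaban1985Variational, p.307 («valid for Gᶜ-valued fields»; bookkeeping)] -/
theorem contDiff_stepMh_two (s : T4Continuum.LStep P j) : ContDiff ℂ ⊤ (fun V : PBond P j → MatA 2 => stepMh V s) := by
  have hev : ContDiff ℂ ⊤ (fun V : PBond P j → MatA 2 => V s.bond) := contDiff_apply ℂ (MatA 2) s.bond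
  unfold stepMh
  by_cases h : s.fwd
  · simp only [h, if_true]; exact hev
  · simp only [h]; exact contDiff_adjugate_two.comp hev

/-- Holomorphic walk products are `C^ω`. [cite: Balaban1987RG1, (0.4) p.253 («analytic function»; bookkeeping)] -/
theorem contDiff_holMh_two : ∀ γ : List (T4Continuum.LStep P j), ContDiff ℂ ⊤ (fun V : PBond P j → MatA 2 => holMh V γ)
  | [] => by simp only [holMh_nil]; exact contDiff_const
  | s :: γ => by simp only [holMh_cons]; exact (contDiff_stepMh_two s).mul (contDiff_holMh_two γ)

/-- ★ **THE HOLOMORPHIC (0.4) MODEL IS `C^ω` OVER ℂ (whole map) at every field whose loop matrices lie in the polydisc `‖W − 1‖ < 1`.**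
[cite: Balaban1987RG1, (0.4) p.253 («we assume that it is an analytic function»); Balaban1985Variational, Prop. 9 p.309] -/
theorem contDiffAt_avgMh_two {V₀ : PBond P j → MatA 2} (h : ∀ (c : PBond P (j + 1)) (i : Idx P), ‖loopMh V₀ c i - 1‖ < 1) :
    ContDiffAt ℂ ⊤ (avgMh : (PBond P j → MatA 2) → PBond P (j + 1) → MatA 2) V₀ := by
  refine contDiffAt_pi.2 fun c => ?_
  have hin : ContDiff ℂ ⊤ (fun V : PBond P j → MatA 2 => fun i : Idx P => loopMh V c i) := contDiff_pi.2 fun i => contDiff_holMh_two _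
  have heml : ContDiffAt ℂ ⊤ (eml : (Idx P → MatA 2) → MatA 2) (fun i => loopMh V₀ c i) := (analyticAt_eml (𝔸 := MatA 2) (h c)).contDiffAt
  have hcorr : ContDiffAt ℂ ⊤ (fun V : PBond P j → MatA 2 => corrMh V c) V₀ := heml.comp V₀ hin.contDiffAt
  exact hcorr.mul (contDiff_holMh_two _).contDiffAt

end Model

/-! ## §3  At `SU(2)` fields the holomorphic response IS `LQ̃`: `A₁^ℂ(c)(↑Vk) = A₁(c)(Vk)` -/

variable (F : T4Family)

/-- ★★ **THE REAL AND THE HOLOMORPHIC RESPONSE AGREE ON TANGENT DIRECTIONS at `SU(2)` fields in the guard**: `D_ℝ(W ↦ avgM W c)(↑Vk)[B′·↑Vk] = D_ℂ avgMh(↑Vk)[B′·↑Vk](c)` — both are the velocity at `0`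
of the SU-valued curve `s ↦ Ū(V′_sV^{(k)})(c)`, along which `avgMh = avgM` pointwise. [cite: Balaban1987RG1, (0.4) p.253; Balaban1985Variational, Prop. 9 p.309] -/
theorem fderiv_avgM_tangent_eq_fderiv_avgMh (k K : ℕ) (hk : k + 1 ≤ (F.P K).m + (F.P K).K) (Vk : GaugeField (F.P K) k (SU 2))
    (hs : ∀ c : PBond (F.P K) (k + 1), Small expMeanLogSU Vk c) (x : FluctIdx F k K → ℝ) (c : PBond (F.P K) (k + 1)) :
    fderiv ℝ (fun W : PBond (F.P K) k → MatA 2 => avgM W c) (coeField Vk) (fun b => fluctMat F k K x b * ((Vk b : SU 2) : MatA 2)) =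
      fderiv ℂ (avgMh : (PBond (F.P K) k → MatA 2) → PBond (F.P K) (k + 1) → MatA 2) (coeField Vk) (fun b => fluctMat F k K x b * ((Vk b : SU 2) : MatA 2)) c := by
  have h0 : pert F k K Vk ((0 : ℝ) • x) = Vk := by rw [zero_smul, pert_zero]
  -- (L) N07's velocity brick
  have hL : HasDerivAt (fun s : ℝ => ((avgFun expMeanLogSU (pert F k K Vk (s • x)) c : SU 2) : MatA 2))
      (fderiv ℝ (fun W : PBond (F.P K) k → MatA 2 => avgM W c) (coeField Vk) (fun b => fluctMat F k K x b * ((Vk b : SU 2) : MatA 2))) 0 := by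
    have h := N07CentralDescendantLifts.hasDerivAt_coe_avgFun_comp_apply_of_small_of_local hk (Φ := fun s : ℝ => pert F k K Vk (s • x)) c
      (by rw [h0]; exact hs c) (Vdot := fun b => fluctMat F k K x b * ((Vk b : SU 2) : MatA 2)) fun b _ => hasDerivAt_coe_pert_line F k K Vk x b
    rw [h0] at h
    exact h
  -- (R) through the holomorphic model
  have hγ : HasDerivAt (fun s : ℝ => coeField (pert F k K Vk (s • x))) (fun b => fluctMat F k K x b * ((Vk b : SU 2) : MatA 2)) 0 :=
    hasDerivAt_pi.2 fun b => hasDerivAt_coe_pert_line F k K Vk x b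
  have hM : HasFDerivAt (avgMh : (PBond (F.P K) k → MatA 2) → PBond (F.P K) (k + 1) → MatA 2)
      ((fderiv ℂ (avgMh : (PBond (F.P K) k → MatA 2) → PBond (F.P K) (k + 1) → MatA 2) (coeField Vk)).restrictScalars ℝ)
      ((fun s : ℝ => coeField (pert F k K Vk (s • x))) 0) := by
    have e : (fun s : ℝ => coeField (pert F k K Vk (s • x))) 0 = coeField Vk := by simp only [h0]
    rw [e]
    exact (differentiableAt_avgMh_coeField hs).hasFDerivAt.restrictScalars ℝ
  have hcomp := hM.comp_hasDerivAt (0 : ℝ) hγ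
  have hRc : HasDerivAt (fun s : ℝ => avgMh (coeField (pert F k K Vk (s • x))) c)
      (fderiv ℂ (avgMh : (PBond (F.P K) k → MatA 2) → PBond (F.P K) (k + 1) → MatA 2) (coeField Vk) (fun b => fluctMat F k K x b * ((Vk b : SU 2) : MatA 2)) c) 0 :=
    (hasDerivAt_pi.mp hcomp) c
  -- along the curve the two models agree (on the guard, eventually)
  have hguard : ∀ᶠ s in 𝓝 (0 : ℝ), Small expMeanLogSU (pert F k K Vk (s • x)) c :=
    N07AveragingLocalSmooth.eventually_small_comp_of_small_of_local hk (Φ := fun s : ℝ => pert F k K Vk (s • x)) c (by rw [h0]; exact hs c)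
      fun b _ => (hasDerivAt_coe_pert_line F k K Vk x b).continuousAt
  have heq : (fun s : ℝ => ((avgFun expMeanLogSU (pert F k K Vk (s • x)) c : SU 2) : MatA 2)) =ᶠ[𝓝 (0 : ℝ)]
      fun s => avgMh (coeField (pert F k K Vk (s • x))) c :=
    hguard.mono fun s hsml => coe_avgFun_eq_avgMh _ c hsml
  exact hL.unique (hRc.congr_of_eventuallyEq heq)

/-- ★★ **`LQ̃` THROUGH THE HOLOMORPHIC MODEL**: `(LQ̃(Vk) x)(c) = D_ℂ avgMh(↑Vk)[b ↦ fluctMat x b·↑Vk b](c) · ↑Ū(c)*`. [cite: Balaban1987RG1, p.267, (0.4) p.253] -/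
theorem recordLQt_apply_eq_fderiv_avgMh (k K : ℕ) (hk : k + 1 ≤ (F.P K).m + (F.P K).K) (Vk : GaugeField (F.P K) k (SU 2))
    (hs : ∀ c : PBond (F.P K) (k + 1), Small expMeanLogSU Vk c) (x : FluctIdx F k K → ℝ) (c : PBond (F.P K) (k + 1)) :
    recordLQt F k K Vk x c =
      fderiv ℂ (avgMh : (PBond (F.P K) k → MatA 2) → PBond (F.P K) (k + 1) → MatA 2) (coeField Vk) (fun b => fluctMat F k K x b * ((Vk b : SU 2) : MatA 2)) c *
        star (((avgFun expMeanLogSU Vk c : SU 2) : MatA 2)) := by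
  rw [recordLQt_apply_eq_fderiv_avgM F k K hk Vk hs x c, fderiv_avgM_tangent_eq_fderiv_avgMh F k K hk Vk hs x c]

/-- The inverse of the matrix of `Ū(c)` is its adjoint. [folklore] -/
theorem inv_coe_avgFun (k K : ℕ) (Vk : GaugeField (F.P K) k (SU 2)) (c : PBond (F.P K) (k + 1)) :
    (((avgFun expMeanLogSU Vk c : SU 2) : MatA 2))⁻¹ = star (((avgFun expMeanLogSU Vk c : SU 2) : MatA 2)) :=
  Matrix.inv_eq_left_inv (star_mul_coe_self_SU _)

open Classical in
/-- ★★ **AT `SU(2)` FIELDS IN THE GUARD THE HOLOMORPHIC BLOCK IS DEF-1's BLOCK**: `A₁^ℂ(c)(↑Vk) = A₁(c)(Vk)` (entrywise, real values). [cite: Balaban1987RG1, p.267–268; Balaban1985Variational, Prop. 9 p.309] -/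
theorem jacBlockC_coeField (k K : ℕ) (hk : k + 1 ≤ (F.P K).m + (F.P K).K) (Vk : GaugeField (F.P K) k (SU 2))
    (hs : ∀ c : PBond (F.P K) (k + 1), Small expMeanLogSU Vk c) (c : PBond (F.P K) (k + 1)) :
    jacBlockC c (coeField Vk) = (Matrix.of fun j j' : Fin 3 => recordLQtB0 F k K Vk (c, j) (c, j')).map ((↑) : ℝ → ℂ) := by
  ext i a
  rw [Matrix.map_apply, Matrix.of_apply, jacBlockC, Matrix.of_apply]
  have hdir : (Pi.single (centralBond c) (su2Gen a * coeField Vk (centralBond c)) : PBond (F.P K) k → MatA 2) =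
      fun b => fluctMat F k K (Pi.single (recordB0 F k K c, a) (1 : ℝ)) b * ((Vk b : SU 2) : MatA 2) := by
    funext b
    rw [fluctMat_single]
    by_cases hb : b = recordB0 F k K c
    · subst hb
      show (Pi.single (centralBond c) (su2Gen a * coeField Vk (centralBond c)) : PBond (F.P K) k → MatA 2) (centralBond c) = _
      rw [Pi.single_eq_same, if_pos rfl, coeField_apply]; rfl
    · have hb' : b ≠ centralBond c := hb
      rw [Pi.single_eq_of_ne hb', if_neg hb, zero_mul]
  have havg : avgMh (coeField Vk) c = ((avgFun expMeanLogSU Vk c : SU 2) : MatA 2) := (coe_avgFun_eq_avgMh Vk c (hs c)).symm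
  rw [hdir, havg, inv_coe_avgFun, ← recordLQt_apply_eq_fderiv_avgMh F k K hk Vk hs _ c,
    su2CoordC_of_mem_lieSU (recordLQt_mem_lieSU_of_small F k K Vk hs _ c)]
  rfl

open Classical in
/-- **… hence `det A₁^ℂ(c)(↑Vk) = det A₁(c)(Vk)` (as a real number).** [cite: Balaban1987RG1, p.267–268 (bookkeeping)] -/
theorem det_jacBlockC_coeField (k K : ℕ) (hk : k + 1 ≤ (F.P K).m + (F.P K).K) (Vk : GaugeField (F.P K) k (SU 2))
    (hs : ∀ c : PBond (F.P K) (k + 1), Small expMeanLogSU Vk c) (c : PBond (F.P K) (k + 1)) :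
    (jacBlockC c (coeField Vk)).det = (((Matrix.of fun j j' : Fin 3 => recordLQtB0 F k K Vk (c, j) (c, j')).det : ℝ) : ℂ) := by
  rw [jacBlockC_coeField F k K hk Vk hs c]
  exact (RingHom.map_det Complex.ofRealHom _).symm

open Classical in
/-- ★ **… and the holomorphic Jacobian factor is the real one**: if `det A₁(c)(Vk) > 0` (true near the flat point, where it is `(N_c∕|I|)³`), `jacFactorC c ↑Vk = log|det A₁(c)(Vk)|`.
[cite: Balaban1987RG1, p.268, (1.18) p.263] -/
theorem jacFactorC_coeField (k K : ℕ) (hk : k + 1 ≤ (F.P K).m + (F.P K).K) (Vk : GaugeField (F.P K) k (SU 2))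
    (hs : ∀ c : PBond (F.P K) (k + 1), Small expMeanLogSU Vk c) (c : PBond (F.P K) (k + 1))
    (hpos : 0 < (Matrix.of fun j j' : Fin 3 => recordLQtB0 F k K Vk (c, j) (c, j')).det) :
    jacFactorC c (coeField Vk) = ((Real.log |(Matrix.of fun j j' : Fin 3 => recordLQtB0 F k K Vk (c, j) (c, j')).det| : ℝ) : ℂ) := by
  rw [jacFactorC, det_jacBlockC_coeField F k K hk Vk hs c, abs_of_pos hpos, Complex.ofReal_log hpos.le]

/-! ## §4  ★★ The holomorphic block and Jacobian factor are `C^ω` over ℂ (row (a) of `stub_LZjac` at the level of one torus) -/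

section Smooth

variable {P : Params} {j : ℕ}

/-- ★★ **THE ENTRIES OF `A₁^ℂ(c)(·)` ARE `C^ω` OVER ℂ** at every field whose loop matrices lie in the polydisc (all coarse bonds) and whose average at `c` is invertible: second derivative of the
`C^ω` model applied to a linear direction field, times the analytic `Ring.inverse`, read in linear coordinates. [cite: Balaban1987RG1, (0.4) p.253 («analytic function»), p.267; Balaban1985Variational, Prop. 9 p.309] -/
theorem contDiffAt_jacBlockC_apply {W₀ : PBond P j → MatA 2} (h : ∀ (c : PBond P (j + 1)) (i : Idx P), ‖loopMh W₀ c i - 1‖ < 1)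
    (c : PBond P (j + 1)) (hU : IsUnit (avgMh W₀ c)) (i a : Fin 3) :
    ContDiffAt ℂ ⊤ (fun W : PBond P j → MatA 2 => jacBlockC c W i a) W₀ := by
  have hmodel := contDiffAt_avgMh_two h
  have hf : ContDiffAt ℂ ⊤ (fun W => fderiv ℂ (avgMh : (PBond P j → MatA 2) → PBond P (j + 1) → MatA 2) W) W₀ :=
    hmodel.fderiv_right (m := ⊤) le_top
  have hv : ContDiff ℂ ⊤ (fun W : PBond P j → MatA 2 => (Pi.single (centralBond c) (su2Gen a * W (centralBond c)) : PBond P j → MatA 2)) := by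
    refine contDiff_pi.2 fun b => ?_
    by_cases hb : b = centralBond c
    · subst hb
      simp only [Pi.single_eq_same]
      exact contDiff_const.mul (contDiff_apply ℂ (MatA 2) _)
    · simp only [Pi.single_eq_of_ne hb]
      exact contDiff_const
  have happ : ContDiffAt ℂ ⊤ (fun W => fderiv ℂ (avgMh : (PBond P j → MatA 2) → PBond P (j + 1) → MatA 2) W
      (Pi.single (centralBond c) (su2Gen a * W (centralBond c)))) W₀ := hf.clm_apply hv.contDiffAt
  have hc : ContDiffAt ℂ ⊤ (fun W => fderiv ℂ (avgMh : (PBond P j → MatA 2) → PBond P (j + 1) → MatA 2) W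
      (Pi.single (centralBond c) (su2Gen a * W (centralBond c))) c) W₀ :=
    (contDiff_apply ℂ (MatA 2) c).contDiffAt.comp W₀ happ
  have havg : ContDiffAt ℂ ⊤ (fun W : PBond P j → MatA 2 => avgMh W c) W₀ := (contDiff_apply ℂ (MatA 2) c).contDiffAt.comp W₀ hmodel
  obtain ⟨u, hu⟩ := hU
  have hinv : ContDiffAt ℂ ⊤ (fun W : PBond P j → MatA 2 => (avgMh W c)⁻¹) W₀ := by
    have e : (fun W : PBond P j → MatA 2 => (avgMh W c)⁻¹) = fun W => Ring.inverse (avgMh W c) :=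
      funext fun W => Matrix.nonsing_inv_eq_ringInverse _
    rw [e]
    have hri : ContDiffAt ℂ ⊤ (Ring.inverse : MatA 2 → MatA 2) (avgMh W₀ c) := by rw [← hu]; exact contDiffAt_ringInverse ℂ u
    exact hri.comp W₀ havg
  show ContDiffAt ℂ ⊤ (fun W : PBond P j → MatA 2 => su2CoordC (fderiv ℂ (avgMh : (PBond P j → MatA 2) → PBond P (j + 1) → MatA 2) W
      (Pi.single (centralBond c) (su2Gen a * W (centralBond c))) c * (avgMh W c)⁻¹) i) W₀
  exact (contDiff_su2CoordC i).contDiffAt.comp W₀ (hc.mul hinv)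

/-- ★★ **`det A₁^ℂ(c)(·)` IS `C^ω` OVER ℂ** (a polynomial in the nine `C^ω` entries). [cite: Balaban1987RG1, p.268, (1.18) p.263] -/
theorem contDiffAt_det_jacBlockC {W₀ : PBond P j → MatA 2} (h : ∀ (c : PBond P (j + 1)) (i : Idx P), ‖loopMh W₀ c i - 1‖ < 1)
    (c : PBond P (j + 1)) (hU : IsUnit (avgMh W₀ c)) :
    ContDiffAt ℂ ⊤ (fun W : PBond P j → MatA 2 => (jacBlockC c W).det) W₀ := by
  have he : ∀ i a : Fin 3, ContDiffAt ℂ ⊤ (fun W : PBond P j → MatA 2 => jacBlockC c W i a) W₀ := fun i a => contDiffAt_jacBlockC_apply h c hU i a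
  simp only [Matrix.det_fin_three]
  exact ((((((he 0 0).mul (he 1 1)).mul (he 2 2)).sub (((he 0 0).mul (he 1 2)).mul (he 2 1))).sub (((he 0 1).mul (he 1 0)).mul (he 2 2))).add
    (((he 0 1).mul (he 1 2)).mul (he 2 0))).add (((he 0 2).mul (he 1 0)).mul (he 2 1)) |>.sub (((he 0 2).mul (he 1 1)).mul (he 2 0))

/-- ★★ **THE HOLOMORPHIC JACOBIAN FACTOR IS ANALYTIC** at every polydisc field with invertible average whose `det A₁^ℂ(c)` lies off the closed negative real axis (e.g. near the flat value
`(N_c∕|I|)³ > 0`). [cite: Balaban1987RG1, (1.18) p.263 («analytic functions on the spaces (1.11)–(1.16)»), p.268] -/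
theorem analyticAt_jacFactorC {W₀ : PBond P j → MatA 2} (h : ∀ (c : PBond P (j + 1)) (i : Idx P), ‖loopMh W₀ c i - 1‖ < 1)
    (c : PBond P (j + 1)) (hU : IsUnit (avgMh W₀ c)) (hslit : (jacBlockC c W₀).det ∈ Complex.slitPlane) :
    AnalyticAt ℂ (jacFactorC c : (PBond P j → MatA 2) → ℂ) W₀ := by
  show AnalyticAt ℂ (fun W : PBond P j → MatA 2 => Complex.log (jacBlockC c W).det) W₀
  exact ((contDiffAt_det_jacBlockC h c hU).analyticAt).clog hslit

end Smooth

/-- ★★ **AT THE RECORD's REAL FIELDS**: for `Vk` in the guard at every coarse bond with `det A₁(c)(Vk) > 0` (the flat value is `(N_c∕|I|)³`), the holomorphic Jacobian factor is ANALYTIC at `↑Vk`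
and equals `log|det A₁(c)(Vk)|` there. [cite: Balaban1987RG1, (1.18) p.263, p.268; Balaban1985Variational, Prop. 9 p.309] -/
theorem analyticAt_jacFactorC_coeField (k K : ℕ) (hk : k + 1 ≤ (F.P K).m + (F.P K).K) (Vk : GaugeField (F.P K) k (SU 2))
    (hs : ∀ c : PBond (F.P K) (k + 1), Small expMeanLogSU Vk c) (c : PBond (F.P K) (k + 1))
    (hpos : 0 < (Matrix.of fun j j' : Fin 3 => recordLQtB0 F k K Vk (c, j) (c, j')).det) :
    AnalyticAt ℂ (jacFactorC c : (PBond (F.P K) k → MatA 2) → ℂ) (coeField Vk) := by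
  have hpoly : ∀ (c' : PBond (F.P K) (k + 1)) (i : Idx (F.P K)), ‖loopMh (coeField Vk) c' i - 1‖ < 1 := fun c' i => by
    rw [loopMh_coeField]; exact norm_loopM_coeField_sub_one_lt_one Vk c' (hs c') i
  have hU : IsUnit (avgMh (coeField Vk) c) := by
    rw [← coe_avgFun_eq_avgMh Vk c (hs c)]
    exact ⟨⟨_, _, coe_mul_star_self_SU (avgFun expMeanLogSU Vk c), star_mul_coe_self_SU (avgFun expMeanLogSU Vk c)⟩, rfl⟩
  refine analyticAt_jacFactorC hpoly c hU ?_
  rw [det_jacBlockC_coeField F k K hk Vk hs c]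
  exact Complex.ofReal_mem_slitPlane.2 hpos

end Summit.QuantumFields.YangMills.Theorems.BalabanUVNodesPortS1

end
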